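import Summits.Ventures.Crystal3D.LocalLP.LevyCap
import Summits.Ventures.Crystal3D.LocalLP.Saturation
import Mathlib.Tactic.IntervalCases
import HarnessLib

/-!
# Two consequences of the Lévy–Schmidt fact: the rung `6N - 1.67 N^{2/3}` and Bezdek's
# Conjecture 3.5 in covering form

HONEST FRAMING. Part of the venture `Summits/Ventures/Crystal3D` (cell `pub-crystal3d`). Both
theorems below are CONDITIONAL on the Literature named fact
`Schmidt1948_sphericalIsoperimetric` (Lévy–Schmidt spherical isoperimetric inequality, FLM 1977
Thm 2.1 — classical, not proved in the tree); the first one additionally on the isoperimetric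
input `IsoInput 1 (1/4)` of `LocalLP/SurfaceComposition.lean` (classical isoperimetric
inequality of `ℝ³` for unions of balls; not proved in the tree). Everything else is kernel-checked.

* `surfaceBound_levy` — `Schmidt1948… → IsoInput 1 (1/4) → ∀ N ≥ 2, ∀ packing of N
  diameter-1 balls in ℝ³, C < 6N - (167/100) N^{2/3}`: the pure-Lévy rung of the cell's ladder
  (`γ = 1.67 < 2π / fLevy2 11 = 1.6732…`, binding type `k = 11`, no vertex removal needed beyond
  isolated balls), with `(L)` supplied by `levyCapInput_one` and `(K)` by `saturationInput_one`.
* `bezdek_conjecture35_covering` — the COVERING FORM of K. Bezdek's Conjecture 3.5 (Discrete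
  Comput. Geom. 48 (2012), = Conj. 3.11 of arXiv:1102.1198v2 §3.2), equivalent to the printed
  form by elementary cap algebra (cell file `lit/lean/BezdekConjecture35AsPrinted.lean`,
  `printed_iff_covering_pointwise`): for unit vectors `u₁, …, u_M` pairwise at angle `≥ π/3`,
  the open `π/3`-caps about them cover at least the fraction `M/12` of the sphere (exactly the cell's `Bezdek2012_conjecture35_coveringForm`, with `σ` = the writer's `sphereFraction`). Cases:
  `M ≥ 13` vacuous and `M = 12` full covering by the tree's kissing-number theorem, `1 ≤ M ≤ 11`
  by the Lévy bound of `LocalLP/LevyCap.lean` applied to the packing `{0, u₁, …, u_M}` plus the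
  certified margins `g_M ≤ (12 - M) g₁₁ < (12 - M)/6` of seat p2.
No crystallization statement is claimed.
-/

noncomputable section

open scoped BigOperators RealInnerProductSpace Topology
open Finset Real InnerProductGeometry MeasureTheory Set Filter

namespace Summit.Ventures.Crystal3D

open Literature.Geometry.DiscreteGeometry (ballFraction sphereFraction sphCap rayCone
  Schmidt1948_sphericalIsoperimetric sphereFraction_mono sphereFraction_le_one
  sphereFraction_nonneg sphereFraction_sphere musin2006_kissing_three_holds)
open Summit.Ventures.Crystal3D.Inequalities (cθ g fLevy2 fLevy2_le fLevy2_eleven_pos gamma_gt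
  g_le_deficit_mul_g_eleven g_eleven_bounds)

/-! ## The pure-Lévy rung of the surface bound -/

/-- **`C < 6N - 1.67 N^{2/3}` from Lévy–Schmidt and the isoperimetric input.** -/
theorem surfaceBound_levy (hLevy : Schmidt1948_sphericalIsoperimetric) (hI : IsoInput 1 (1 / 4)) :
    ∀ N : ℕ, 2 ≤ N → ∀ x : Fin N → EuclideanSpace ℝ (Fin 3), IsUnitPacking x →
      (numContacts x : ℝ) < 6 * N - (167 / 100 : ℝ) * (N : ℝ) ^ ((2 : ℝ) / 3) := by
  have hπ : 0 < π := pi_pos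
  have hf11 := fLevy2_eleven_pos
  refine surfaceBound_of_inputs (ρ := fLevy2 11 / (16 * π)) (k₀ := 0) (N₁ := 2)
    (levyCapInput_one hLevy) saturationInput_one hI (by positivity) ?table ?gamma le_rfl
    ?base ?step
  case table =>
    intro k hk hk11
    rw [div_mul_eq_mul_div]
    exact div_le_div_of_nonneg_right (fLevy2_le k (by omega) hk11) (by positivity)
  case gamma =>
    have h : (1 / 4 : ℝ) / (2 * (fLevy2 11 / (16 * π))) = 2 * π / fLevy2 11 := by
      field_simp; ring
    rw [h]
    linarith [gamma_gt]
  case base =>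
    intro N hN2 hN2' x _
    have hN : N = 2 := le_antisymm hN2' hN2
    subst hN
    exact base_case_of_choose_two (q := 8 / 5) (by norm_num)
      (rpow_two_thirds_le_of_sq_le_cube (by norm_num) (by norm_num) (by norm_num))
      (by norm_num) x
  case step =>
    refine step_of_threshold (by norm_num) (by norm_num) ?_
    have h2 : (1 : ℝ) ≤ (2 : ℝ) ^ ((1 : ℝ) / 3) :=
      Real.one_le_rpow (by norm_num) (by norm_num)
    push_cast
    linarith

/-! ## Bezdek's Conjecture 3.5, covering form -/

/-- Subadditivity of the sphere fraction. -/
theorem sphereFraction_union_le (A B : Set (EuclideanSpace ℝ (Fin 3))) :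
    sphereFraction (A ∪ B) ≤ sphereFraction A + sphereFraction B := by
  have hV : 0 < (volume (Metric.ball (0 : EuclideanSpace ℝ (Fin 3)) 1)).toReal :=
    ENNReal.toReal_pos (Metric.measure_ball_pos volume (0 : EuclideanSpace ℝ (Fin 3)) one_pos).ne'
      measure_ball_lt_top.ne
  have hcone : rayCone (A ∪ B) = rayCone A ∪ rayCone B := by
    ext v; simp only [rayCone, Set.mem_union, Set.mem_setOf_eq]; tauto
  change (volume (Metric.ball 0 1 ∩ rayCone (A ∪ B))).toReal / _ ≤
    (volume (Metric.ball 0 1 ∩ rayCone A)).toReal / _ + (volume (Metric.ball 0 1 ∩ rayCone B)).toReal / _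
  rw [← add_div, hcone, Set.inter_union_distrib_left]
  refine div_le_div_of_nonneg_right ?_ hV.le
  have hfin : ∀ S : Set (EuclideanSpace ℝ (Fin 3)), volume (Metric.ball (0 : EuclideanSpace ℝ (Fin 3)) 1 ∩ S) ≠ ⊤ :=
    fun S => ((measure_mono Set.inter_subset_left).trans_lt measure_ball_lt_top).ne
  rw [← ENNReal.toReal_add (hfin _) (hfin _)]
  exact ENNReal.toReal_mono (ENNReal.add_ne_top.2 ⟨hfin _, hfin _⟩) (measure_union_le _ _)

variable {M : ℕ}

/-- The OPEN spherical cap of angular radius `r` about `u` (as in the printed conjecture; same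
expression as the cell's `lit/lean/BezdekConjecture35AsPrinted.lean`). -/
def sphOpenCap (u : EuclideanSpace ℝ (Fin 3)) (r : ℝ) : Set (EuclideanSpace ℝ (Fin 3)) :=
  {v | ‖v‖ = 1 ∧ angle u v < r}

/-- For unit vectors, angle `≥ π/3` gives `⟪a, b⟫ ≤ 1/2`. -/
theorem inner_le_half_of_angle_ge {a b : EuclideanSpace ℝ (Fin 3)} (ha : ‖a‖ = 1) (hb : ‖b‖ = 1)
    (h : π / 3 ≤ angle a b) : ⟪a, b⟫ ≤ 1 / 2 := by
  have hcos : cos (angle a b) ≤ cos (π / 3) :=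
    Real.cos_le_cos_of_nonneg_of_le_pi (by positivity) (angle_le_pi a b) h
  rw [cos_angle, ha, hb, mul_one, div_one, cos_pi_div_three] at hcos
  exact hcos

/-- The packing `{0, u₁, …, u_M}` built from a spherical code. -/
def codeConfig (u : Fin M → EuclideanSpace ℝ (Fin 3)) : Fin (M + 1) → EuclideanSpace ℝ (Fin 3) :=
  Fin.cons 0 u

/-- A spherical code with pairwise angles `≥ π/3` (pairwise inner products `≤ 1/2`) gives a unit
packing `{0, u₁, …, u_M}`. -/
theorem isUnitPacking_codeConfig {u : Fin M → EuclideanSpace ℝ (Fin 3)} (hu : ∀ m, ‖u m‖ = 1)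
    (hang : ∀ m m', m ≠ m' → ⟪u m, u m'⟫ ≤ 1 / 2) : IsUnitPacking (codeConfig u) := by
  -- ordered pairs first
  have key : ∀ a b : Fin (M + 1), a < b → 1 ≤ dist (codeConfig u a) (codeConfig u b) := by
    intro a b hab
    rcases Fin.eq_zero_or_eq_succ b with rfl | ⟨m', rfl⟩
    · exact absurd hab (Fin.not_lt_zero a)
    rcases Fin.eq_zero_or_eq_succ a with rfl | ⟨m, rfl⟩
    · simp [codeConfig, hu m']
    · have hmm : m ≠ m' := fun h => (ne_of_lt hab) (by rw [h])
      simp only [codeConfig, Fin.cons_succ, dist_eq_norm]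
      have h1 : 1 ≤ ‖u m - u m'‖ ^ 2 := by
        rw [norm_sub_sq_real, hu m, hu m']; linarith [hang m m' hmm]
      nlinarith [norm_nonneg (u m - u m')]
  intro a b hab
  rcases lt_or_gt_of_ne hab with h | h
  · exact key a b h
  · rw [dist_comm]; exact key b a h

/-- In that packing the contact neighbours of the centre `0` are all the code vectors. -/
theorem contactNeighbors_codeConfig_zero {u : Fin M → EuclideanSpace ℝ (Fin 3)}
    (hu : ∀ m, ‖u m‖ = 1) :
    contactNeighbors (codeConfig u) 0 = Finset.univ.image Fin.succ := by
  ext j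
  rw [mem_contactNeighbors, Finset.mem_image]
  constructor
  · rintro ⟨hj, -⟩
    obtain ⟨m, rfl⟩ := Fin.exists_succ_eq.2 hj
    exact ⟨m, Finset.mem_univ _, rfl⟩
  · rintro ⟨m, -, rfl⟩
    refine ⟨Fin.succ_ne_zero m, ?_⟩
    simp [codeConfig, hu m]

/-- Hence the centre has coordination `M`. -/
theorem coordination_codeConfig_zero {u : Fin M → EuclideanSpace ℝ (Fin 3)}
    (hu : ∀ m, ‖u m‖ = 1) : coordination (codeConfig u) 0 = M := by
  rw [coordination, contactNeighbors_codeConfig_zero hu,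
    Finset.card_image_of_injective _ (Fin.succ_injective M)]
  simp

/-- The uncovered set of the centre is the complement of the open `π/3`-caps: unit `v` with
`⟪v, u m⟫ ≤ 1/2` for all `m`. -/
theorem mem_uncoveredDir_codeConfig_zero {u : Fin M → EuclideanSpace ℝ (Fin 3)}
    (hu : ∀ m, ‖u m‖ = 1) {v : EuclideanSpace ℝ (Fin 3)} :
    v ∈ uncoveredDir (codeConfig u) 0 ↔ ‖v‖ = 1 ∧ ∀ m, ⟪v, u m⟫ ≤ 1 / 2 := by
  unfold uncoveredDir
  rw [Set.mem_setOf_eq, contactNeighbors_codeConfig_zero hu]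
  constructor
  · rintro ⟨hv, h⟩
    refine ⟨hv, fun m => ?_⟩
    have := h (Fin.succ m) (Finset.mem_image.2 ⟨m, Finset.mem_univ _, rfl⟩)
    simpa [codeConfig] using this
  · rintro ⟨hv, h⟩
    refine ⟨hv, fun j hj => ?_⟩
    obtain ⟨m, -, rfl⟩ := Finset.mem_image.1 hj
    simpa [codeConfig] using h m

/-- The sphere is covered by the uncovered set together with the OPEN `π/3`-caps. -/
theorem sphere_subset_uncovered_union_caps {u : Fin M → EuclideanSpace ℝ (Fin 3)}
    (hu : ∀ m, ‖u m‖ = 1) :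
    {v : EuclideanSpace ℝ (Fin 3) | ‖v‖ = 1} ⊆
      uncoveredDir (codeConfig u) 0 ∪ ⋃ m, sphOpenCap (u m) (π / 3) := by
  intro v hv
  by_cases h : ∀ m, ⟪v, u m⟫ ≤ 1 / 2
  · exact Or.inl ((mem_uncoveredDir_codeConfig_zero hu).2 ⟨hv, h⟩)
  · obtain ⟨m, hm⟩ := not_forall.1 h
    have hm' : 1 / 2 < ⟪v, u m⟫ := not_le.1 hm
    refine Or.inr (Set.mem_iUnion.2 ⟨m, hv, ?_⟩)
    -- angle (u m) v < π/3 from cos (angle) = ⟪u m, v⟫ > 1/2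
    have hcos : cos (π / 3) < cos (angle (u m) v) := by
      rw [cos_angle, hu m, hv, mul_one, div_one, cos_pi_div_three, real_inner_comm]; exact hm'
    by_contra hlt
    have hle : π / 3 ≤ angle (u m) v := not_lt.1 hlt
    exact absurd hcos (not_lt.2 (Real.cos_le_cos_of_nonneg_of_le_pi (by positivity)
      (angle_le_pi _ _) hle))

/-- With twelve code vectors the uncovered set is empty (kissing number twelve). -/
theorem uncoveredDir_codeConfig_eq_empty_of_twelve {u : Fin 12 → EuclideanSpace ℝ (Fin 3)}
    (hu : ∀ m, ‖u m‖ = 1) (hang : ∀ m m', m ≠ m' → ⟪u m, u m'⟫ ≤ 1 / 2) :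
    uncoveredDir (codeConfig u) 0 = ∅ := by
  classical
  ext v
  simp only [Set.mem_empty_iff_false, iff_false]
  intro hv
  obtain ⟨hv1, hvm⟩ := (mem_uncoveredDir_codeConfig_zero hu).1 hv
  -- thirteen unit vectors pairwise at distance ≥ 1
  have hsep : ∀ a b : EuclideanSpace ℝ (Fin 3), ‖a‖ = 1 → ‖b‖ = 1 → ⟪a, b⟫ ≤ 1 / 2 → 1 ≤ dist a b := by
    intro a b ha hb hab
    have h1 : 1 ≤ ‖a - b‖ ^ 2 := by rw [norm_sub_sq_real, ha, hb]; linarith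
    rw [dist_eq_norm]; nlinarith [norm_nonneg (a - b)]
  have huinj : Function.Injective u := by
    intro m m' h
    by_contra hne
    have := hsep _ _ (hu m) (hu m') (hang m m' hne)
    rw [h, dist_self] at this
    linarith
  set S : Finset (EuclideanSpace ℝ (Fin 3)) := Finset.univ.image u with hS
  have hScard : S.card = 12 := by rw [hS, Finset.card_image_of_injective _ huinj]; simp
  have hvS : v ∉ S := by
    intro h
    obtain ⟨m, -, rfl⟩ := Finset.mem_image.1 h
    have := hsep _ _ hv1 (hu m) (hvm m)
    rw [dist_self] at this; linarith
  have h13 := musin2006_kissing_three_holds (insert v S) ?_ ?_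
  · rw [Finset.card_insert_of_notMem hvS, hScard] at h13; omega
  · intro w hw
    rcases Finset.mem_insert.1 hw with rfl | hw
    · exact hv1
    · obtain ⟨m, -, rfl⟩ := Finset.mem_image.1 hw; exact hu m
  · intro a ha b hb hab
    rcases Finset.mem_insert.1 ha with rfl | ha'
    · rcases Finset.mem_insert.1 hb with hb' | hb'
      · exact absurd hb'.symm hab
      · obtain ⟨m, -, rfl⟩ := Finset.mem_image.1 hb'
        exact hsep _ _ hv1 (hu m) (hvm m)
    · obtain ⟨m, -, rfl⟩ := Finset.mem_image.1 ha'
      rcases Finset.mem_insert.1 hb with rfl | hb'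
      · rw [dist_comm]; exact hsep _ _ hv1 (hu m) (hvm m)
      · obtain ⟨m', -, rfl⟩ := Finset.mem_image.1 hb'
        exact hsep _ _ (hu m) (hu m') (hang m m' fun h => hab (by rw [h]))

/-- There is no spherical code of thirteen or more vectors with pairwise angles `≥ π/3`. -/
theorem code_card_le_twelve {u : Fin M → EuclideanSpace ℝ (Fin 3)} (hu : ∀ m, ‖u m‖ = 1)
    (hang : ∀ m m', m ≠ m' → ⟪u m, u m'⟫ ≤ 1 / 2) : M ≤ 12 := by
  classical
  have hsep : ∀ m m', m ≠ m' → 1 ≤ dist (u m) (u m') := by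
    intro m m' hmm
    have h1 : 1 ≤ ‖u m - u m'‖ ^ 2 := by rw [norm_sub_sq_real, hu m, hu m']; linarith [hang m m' hmm]
    rw [dist_eq_norm]; nlinarith [norm_nonneg (u m - u m')]
  have huinj : Function.Injective u := by
    intro m m' h
    by_contra hne
    have := hsep m m' hne
    rw [h, dist_self] at this; linarith
  have h := musin2006_kissing_three_holds (Finset.univ.image u)
    (by intro w hw; obtain ⟨m, -, rfl⟩ := Finset.mem_image.1 hw; exact hu m)
    (by
      intro a ha b hb hab
      obtain ⟨m, -, rfl⟩ := Finset.mem_image.1 ha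
      obtain ⟨m', -, rfl⟩ := Finset.mem_image.1 hb
      exact hsep m m' fun h => hab (by rw [h]))
  rw [Finset.card_image_of_injective _ huinj] at h
  simpa using h

/-- The certified margin: `fLevy2 M / (16π) ≤ 1 - M/12` for `1 ≤ M ≤ 11`
(`g_M ≤ (12 - M) g₁₁` and `g₁₁ < 0.149409 < 1/6`). -/
theorem fLevy2_div_le_one_sub (hM1 : 1 ≤ M) (hM11 : M ≤ 11) :
    fLevy2 M / (16 * π) ≤ 1 - (M : ℝ) / 12 := by
  have hπ : 0 < π := pi_pos
  have hg := g_le_deficit_mul_g_eleven hM1 hM11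
  obtain ⟨-, hg11⟩ := g_eleven_bounds
  have hM0 : M ≠ 0 := by omega
  have hM12 : ¬ 12 ≤ M := by omega
  have hfl : fLevy2 M = 8 * π * g M := by simp [fLevy2, hM0, hM12]
  rw [hfl, div_le_iff₀ (by positivity)]
  have hM' : (M : ℝ) ≤ 11 := by exact_mod_cast hM11
  have h12M : (0 : ℝ) ≤ 12 - (M : ℝ) := by linarith
  nlinarith [mul_le_mul_of_nonneg_left hg11.le h12M]

/-- **Bezdek's Conjecture 3.5, covering form** (conditional on the Lévy–Schmidt fact): unit
vectors `u₁, …, u_M` of `ℝ³` with pairwise angles `≥ π/3` have OPEN `π/3`-caps covering at least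
the fraction `M/12` of the unit sphere. -/
theorem bezdek_conjecture35_covering (hLevy : Schmidt1948_sphericalIsoperimetric)
    (M : ℕ) (u : Fin M → EuclideanSpace ℝ (Fin 3)) (hu : ∀ m, ‖u m‖ = 1)
    (hangle : Pairwise fun m l => π / 3 ≤ angle (u m) (u l)) :
    (M : ℝ) / 12 ≤ sphereFraction (⋃ m, sphOpenCap (u m) (π / 3)) := by
  have hang : ∀ m m', m ≠ m' → ⟪u m, u m'⟫ ≤ 1 / 2 :=
    fun m m' h => inner_le_half_of_angle_ge (hu m) (hu m') (hangle h)
  have hM12 := code_card_le_twelve hu hang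
  -- `1 ≤ σ(W) + σ(⋃ caps)`
  have hcover := sphere_subset_uncovered_union_caps hu
  have h1 : 1 ≤ sphereFraction (uncoveredDir (codeConfig u) 0) +
      sphereFraction (⋃ m, sphOpenCap (u m) (π / 3)) := by
    calc (1 : ℝ) = sphereFraction {v : EuclideanSpace ℝ (Fin 3) | ‖v‖ = 1} :=
          sphereFraction_sphere.symm
      _ ≤ sphereFraction (uncoveredDir (codeConfig u) 0 ∪ ⋃ m, sphOpenCap (u m) (π / 3)) :=
          sphereFraction_mono hcover
      _ ≤ _ := sphereFraction_union_le _ _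
  rcases Nat.eq_zero_or_pos M with hM0 | hM1
  · subst hM0; simp [sphereFraction_nonneg]
  rcases Nat.lt_or_ge M 12 with hlt | hge
  · -- `1 ≤ M ≤ 11`: Lévy bound on the uncovered set of the packing `{0, u₁, …, u_M}`
    have hx := isUnitPacking_codeConfig hu hang
    have hk := coordination_codeConfig_zero hu
    have hW := sphereFraction_uncoveredDir_le hLevy hx 0 (by rw [hk]; exact hM1)
      (by rw [hk]; omega)
    rw [hk] at hW
    have hmargin := fLevy2_div_le_one_sub hM1 (by omega)
    linarith
  · -- `M = 12`: full covering
    have hM : M = 12 := le_antisymm hM12 hge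
    subst hM
    have hW0 : sphereFraction (uncoveredDir (codeConfig u) 0) = 0 := by
      rw [uncoveredDir_codeConfig_eq_empty_of_twelve hu hang]
      have : rayCone (∅ : Set (EuclideanSpace ℝ (Fin 3))) = ∅ := by ext v; simp [rayCone]
      simp [sphereFraction, this, ballFraction]
    rw [hW0, zero_add] at h1
    norm_num
    exact h1

end Summit.Ventures.Crystal3D

end
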